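/-
Copyright (c) 2026 the pub-hodgecm-mathlib formalisation cell (harness21).  Prover seat hodgecm-mathlib-K2Liu-p12 (g6), Track B «K2-LIT»,
#184♮ = hLiu418 = `stmt-HodgeConjecture-24832`; #42S block D, row D-2, (σ-A) mini-road ((σ-A) road desk K2Liu-p25 (g3) WORD #45∕#46: brick (an-3c-charts)),
FILE 3 «THE COORDINATE HALF OF THE WITT DICTIONARY».  THEOREMS ONLY (no `def`, no `instance`, no `notation`, no named-fact hypothesis, no `sorry`).
-/
import Mathlib.Data.Matrix.Mul
import Mathlib.Algebra.Algebra.Basic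
import Mathlib.Algebra.BigOperators.Fin
import Mathlib.LinearAlgebra.Pi
import Mathlib.Tactic.LinearCombination
import Mathlib.Tactic.FieldSimp
import Mathlib.Tactic.Ring
import Mathlib.RingTheory.SimpleRing.Basic
import Summits.HodgeConjecture.HodgeConjecture.Theorems.K2LiuIsotropicOrthogonalNormClass   -- ★ p864316 [A4-alg] §3 (ED. 2)
import HarnessLib

/-!
# Crux `HLiu418`, socket #42S block D (row D-2, (σ-A) mini-road), brick (an-3c-charts) FILE 3 `K2LiuConeWittDictionary`:
# THE COORDINATE HALF OF THE `hWitt` DICTIONARY — `t ⊥ (ζ ↦ ζ·s)` IN QUADRATIC COORDINATES IS `Σ_j s_j·τ(t)_j = 0` IN `E_w`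

Cell `hodgecm-mathlib`, crux item hLiu418 = `stmt-HodgeConjecture-24832`; squad K2 ∕ K2Liu, road `K2_Liu`, socket #42S, block D row D-2; (σ-A) mini-road brick
(an-3c-charts).  Lane `--supports stmt-HodgeConjecture-24832 --as helper` (count-neutral helper; closes no socket by itself).

WHAT.  K2Liu-p08's (an-3c) §3a `K2LiuConeWordPackage.conePackage_of_stageLetters` carries ONE algebraic letter by value, the POINTWISE WITT LETTER
`hWitt : ∀ s ≠ 0, Qc s = 0 → ∀ t, (∀ ζ, t ⬝ᵥ Zm s ζ = 0) → qf (t ⊔ s) = 0 ∨ R (qf (t ⊔ s))`, whose payer is ★ p864316 [A4-alg] §3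
`K2LiuIsotropicOrthogonalNormClass.hilbertSymbol_neg_self_pairing_div_det_eq_one` — a statement about `E_w`-vectors `s_E, t_E : Fin 3 → L_w` and a hermitian Gram
matrix.  Between the two sits a DICTIONARY from the `F`-coordinate data `(Zm, Qc, qf)` to `E_w`-data.  THIS FILE is its convention-free half, over ANY field `F`,
`d : F`, quadratic-coordinate slots `eJ : Fin n × Fin 2 ≃ ι₁`, `eJ′ : Fin n × Fin 2 ≃ ι₁′` and the multiplication graph `Zm` pinned by `hZm` (FILE 2's letter), and
ANY commutative `F`-algebra `E′` with a chosen `δ′`, `δ′² = d` (at the record: `E′ = L_w` or `∏_{w∣v} L_w`, `δ′ = ι(δ)`):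
* **`dotProduct_zm_eq`**: `t ⬝ᵥ Zm s ζ = ζ₀·S₁(t,s) + ζ₁·S₂(t,s)`, `S₁ = Σ_j (t_{j0} x_j + t_{j1} y_j)`, `S₂ = Σ_j (d t_{j0} y_j + t_{j1} x_j)`;
* **`forall_dotProduct_zm_eq_zero_iff`**: `(∀ ζ, t ⬝ᵥ Zm s ζ = 0) ↔ S₁ = 0 ∧ S₂ = 0`;
* **`zm_quadCoord_eq_mul`**: in `E′`, `(Zm s ζ)_{j,0} + (Zm s ζ)_{j,1}·δ′ = (ζ₀ + ζ₁δ′)·(x_j + y_jδ′)` — `Zm` IS multiplication;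
* **`sum_quadCoord_mul_swap_eq`**: `Σ_j (x_j + y_jδ′)·(t_{j1} + t_{j0}δ′) = S₂ + S₁·δ′` — the `F`-dot product against the graph reads, in `E′`, as the `E′`-BILINEAR
  product of `s_E` with the SLOT-SWAPPED vector `τ(t)_j := t_{j1} + t_{j0}δ′` (equivalently `re(ζ · Σ_j s_j τ(t)_j δ′⁻¹) = t ⬝ᵥ Zm s ζ`);
* **`forall_dotProduct_zm_eq_zero_iff_sum_eq_zero`**: if `{1, δ′}` is `F`-free in `E′` (`hind`), `(∀ ζ, t ⬝ᵥ Zm s ζ = 0) ↔ Σ_j s_{E,j}·τ(t)_j = 0`.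
ED. 2 (§3–§4, K2Liu-p08 (g6) PIN (1) 2026-09-05T03:01Z «the 𝓕-slot reading is `T := Aₕ⁻¹·σ_w(τ(t))` — a change of variable on the `t`-side»):
* §3 **`conj_dotProduct_mulVec_frameVec`**: for ANY involution `c` and invertible `A`, `(c ∘ s) ⬝ᵥ A *ᵥ (A⁻¹ *ᵥ (c ∘ τ)) = c (s ⬝ᵥ τ)` — so the `E′`-bilinear
  orthogonality `s_E ⬝ᵥ τ(t) = 0` IS ★ p864316's sesquilinear `(σ ∘ s_E) ⬝ᵥ Aₕ *ᵥ T = 0` at `T := Aₕ⁻¹ *ᵥ (σ ∘ τ(t))` (`dotProduct_eq_zero_iff_conj_frameVec`), and the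
  self-pairing of `T` is `c (T ⬝ᵥ τ)` (`conj_frameVec_dotProduct_mulVec_frameVec`);
* §4 **`hWitt_of_normClass`** at the record (`L` CM, `w ∣ v` non-split, `σ_w`, hermitian `Aₕ ∈ M₃(L_w)` with `det Aₕ = ι_w(a)`): for `s ≠ 0` with `s_E`
  isotropic and `t ⊥ image(ζ ↦ Z_s ζ)`, every `b` with `ι_w(b) = h(T, T)` satisfies **`b = 0 ∨ (−b·a⁻¹, θ)_v = 1`** — the `hWitt` letter of 📤 p864773
  `conePackage_of_stageLetters` with `R y :↔ (−(y·a⁻¹), θ)_v = 1`, modulo the consumer's pin (2) (`Qc s = 0 ↔ h(s_E,s_E) = 0`, `ι_w(qf(t ⊔ s)) = κ·h(T,T)`).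
[cite: Omeara1963, §63B] [cite: KudlaRallis1994, §2 (2.10)–(2.12)] [cite: WeilBNT1967, Chap. I §2]
HONEST LABEL.  Count-neutral helper; it retires nothing by itself: `HC_CM` is proved only modulo the 7 printed citations (2 remaining named inputs:
hLiu418 = `stmt-HodgeConjecture-24832`, h413 = `stmt-HodgeConjecture-24833`) until rung 0 closes.

## References
* [Omeara1963] O. T. O'Meara, *Introduction to Quadratic Forms* (1963), §63B.
* [KudlaRallis1994] S. Kudla, S. Rallis, *A regularized Siegel–Weil formula: the first term identity*, Ann. of Math. 140 (1994), §2 (2.10)–(2.12).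
* [WeilBNT1967] A. Weil, *Basic Number Theory* (1967), Chap. I §2.
-/

set_option autoImplicit false
set_option linter.dupNamespace false -- the mandated namespace repeats `HodgeConjecture.HodgeConjecture`

open Matrix

namespace Summit.HodgeConjecture.HodgeConjecture.Cruxes.HLiu418.K2LiuConeWittDictionary

variable {F : Type*} [Field F] {n : ℕ} {ι₁ ι₁' : Type*} [Fintype ι₁]
  (eJ : Fin n × Fin 2 ≃ ι₁) (eJ' : Fin n × Fin 2 ≃ ι₁') (d : F)
  (Zm : (ι₁' → F) → ((Fin 2 → F) →ₗ[F] (ι₁ → F)))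
  (hZm : ∀ (s : ι₁' → F) (ζ : Fin 2 → F) (j : Fin n),
    Zm s ζ (eJ (j, 0)) = ζ 0 * s (eJ' (j, 0)) + d * ζ 1 * s (eJ' (j, 1)) ∧
    Zm s ζ (eJ (j, 1)) = ζ 0 * s (eJ' (j, 1)) + ζ 1 * s (eJ' (j, 0)))

/-! ## §1 The `F`-dot product against the graph, in quadratic coordinates -/

include hZm in
/-- **`t ⬝ᵥ Z_s ζ = ζ₀·S₁ + ζ₁·S₂`** with `S₁ = Σ_j (t_{j0} x_j + t_{j1} y_j)`, `S₂ = Σ_j (d·t_{j0} y_j + t_{j1} x_j)` (reindex along `eJ`, expand `hZm`).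
[cite: WeilBNT1967, Chap. I §2] -/
theorem dotProduct_zm_eq (t : ι₁ → F) (s : ι₁' → F) (ζ : Fin 2 → F) :
    t ⬝ᵥ Zm s ζ =
      ζ 0 * (∑ j, (t (eJ (j, 0)) * s (eJ' (j, 0)) + t (eJ (j, 1)) * s (eJ' (j, 1)))) +
        ζ 1 * (∑ j, (d * t (eJ (j, 0)) * s (eJ' (j, 1)) + t (eJ (j, 1)) * s (eJ' (j, 0)))) := by
  have h1 : ∀ j, Zm s ζ (eJ (j, 0)) = ζ 0 * s (eJ' (j, 0)) + d * ζ 1 * s (eJ' (j, 1)) := fun j => (hZm s ζ j).1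
  have h2 : ∀ j, Zm s ζ (eJ (j, 1)) = ζ 0 * s (eJ' (j, 1)) + ζ 1 * s (eJ' (j, 0)) := fun j => (hZm s ζ j).2
  rw [dotProduct, ← Fintype.sum_equiv eJ (fun p => t (eJ p) * Zm s ζ (eJ p)) _ (fun _ => rfl), Fintype.sum_prod_type]
  simp only [Fin.sum_univ_two, h1, h2, Finset.mul_sum, ← Finset.sum_add_distrib]
  exact Finset.sum_congr rfl fun j _ => by ring

include hZm in
/-- **`t ⊥ image(ζ ↦ Z_s ζ) ↔ S₁ = 0 ∧ S₂ = 0`** (test `ζ = e₀, e₁`). [cite: KudlaRallis1994, §2 (2.10)–(2.12)] -/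
theorem forall_dotProduct_zm_eq_zero_iff (t : ι₁ → F) (s : ι₁' → F) :
    (∀ ζ : Fin 2 → F, t ⬝ᵥ Zm s ζ = 0) ↔
      (∑ j, (t (eJ (j, 0)) * s (eJ' (j, 0)) + t (eJ (j, 1)) * s (eJ' (j, 1)))) = 0 ∧
        (∑ j, (d * t (eJ (j, 0)) * s (eJ' (j, 1)) + t (eJ (j, 1)) * s (eJ' (j, 0)))) = 0 := by
  constructor
  · intro h
    have h0 := h (Pi.single 0 1)
    have h1 := h (Pi.single 1 1)
    rw [dotProduct_zm_eq eJ eJ' d Zm hZm] at h0 h1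
    have e01 : (Pi.single 0 1 : Fin 2 → F) 1 = 0 := Pi.single_eq_of_ne (by decide) _
    have e10 : (Pi.single 1 1 : Fin 2 → F) 0 = 0 := Pi.single_eq_of_ne (by decide) _
    rw [Pi.single_eq_same, e01, one_mul, zero_mul, add_zero] at h0
    rw [Pi.single_eq_same, e10, one_mul, zero_mul, zero_add] at h1
    exact ⟨h0, h1⟩
  · rintro ⟨h0, h1⟩ ζ
    rw [dotProduct_zm_eq eJ eJ' d Zm hZm, h0, h1, mul_zero, mul_zero, add_zero]

/-! ## §2 The reading in a quadratic algebra `E′ ∋ δ′`, `δ′² = d` -/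

section Algebra

variable (E' : Type*) [CommRing E'] [Algebra F E'] (δ' : E') (hδ : δ' * δ' = algebraMap F E' d)

omit [Fintype ι₁] in
include hZm hδ in
/-- **`Z_s` IS MULTIPLICATION**: `(Z_s ζ)_{j,0} + (Z_s ζ)_{j,1}·δ′ = (ζ₀ + ζ₁δ′)·(x_j + y_jδ′)` in `E′`. [cite: Omeara1963, §63B] -/
theorem zm_quadCoord_eq_mul (s : ι₁' → F) (ζ : Fin 2 → F) (j : Fin n) :
    algebraMap F E' (Zm s ζ (eJ (j, 0))) + algebraMap F E' (Zm s ζ (eJ (j, 1))) * δ' =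
      (algebraMap F E' (ζ 0) + algebraMap F E' (ζ 1) * δ') * (algebraMap F E' (s (eJ' (j, 0))) + algebraMap F E' (s (eJ' (j, 1))) * δ') := by
  rw [(hZm s ζ j).1, (hZm s ζ j).2]
  simp only [map_add, map_mul]
  linear_combination (-(algebraMap F E' (ζ 1) * algebraMap F E' (s (eJ' (j, 1))))) * hδ

omit [Fintype ι₁] in
include hδ in
/-- **THE SLOT-SWAP READING**: `Σ_j (x_j + y_jδ′)·(t_{j1} + t_{j0}δ′) = S₂ + S₁·δ′` — the two sums of `dotProduct_zm_eq` are the quadratic coordinates of the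
`E′`-bilinear product of `s_E` with `τ(t)_j := t_{j1} + t_{j0}δ′`. [cite: Omeara1963, §63B] -/
theorem sum_quadCoord_mul_swap_eq (t : ι₁ → F) (s : ι₁' → F) :
    ∑ j, (algebraMap F E' (s (eJ' (j, 0))) + algebraMap F E' (s (eJ' (j, 1))) * δ') *
        (algebraMap F E' (t (eJ (j, 1))) + algebraMap F E' (t (eJ (j, 0))) * δ') =
      algebraMap F E' (∑ j, (d * t (eJ (j, 0)) * s (eJ' (j, 1)) + t (eJ (j, 1)) * s (eJ' (j, 0)))) +
        algebraMap F E' (∑ j, (t (eJ (j, 0)) * s (eJ' (j, 0)) + t (eJ (j, 1)) * s (eJ' (j, 1)))) * δ' := by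
  simp only [map_sum, map_add, map_mul, Finset.sum_mul, ← Finset.sum_add_distrib]
  exact Finset.sum_congr rfl fun j _ => by
    linear_combination (algebraMap F E' (s (eJ' (j, 1))) * algebraMap F E' (t (eJ (j, 0)))) * hδ

include hZm hδ in
/-- **`t ⊥ image(ζ ↦ Z_s ζ) ↔ Σ_j s_{E,j}·τ(t)_j = 0` in `E′`**, provided `{1, δ′}` is `F`-free in `E′` (`hind`; automatic when `E′` is a field in which `d`
is not a square). [cite: KudlaRallis1994, §2 (2.10)–(2.12)] [cite: Omeara1963, §63B] -/
theorem forall_dotProduct_zm_eq_zero_iff_sum_eq_zero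
    (hind : ∀ a b : F, algebraMap F E' a + algebraMap F E' b * δ' = 0 → a = 0 ∧ b = 0) (t : ι₁ → F) (s : ι₁' → F) :
    (∀ ζ : Fin 2 → F, t ⬝ᵥ Zm s ζ = 0) ↔
      ∑ j, (algebraMap F E' (s (eJ' (j, 0))) + algebraMap F E' (s (eJ' (j, 1))) * δ') *
        (algebraMap F E' (t (eJ (j, 1))) + algebraMap F E' (t (eJ (j, 0))) * δ') = 0 := by
  rw [forall_dotProduct_zm_eq_zero_iff eJ eJ' d Zm hZm, sum_quadCoord_mul_swap_eq eJ eJ' d E' δ' hδ]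
  constructor
  · rintro ⟨h0, h1⟩
    rw [h0, h1, map_zero, zero_mul, add_zero]
  · intro h
    exact ⟨(hind _ _ h).2, (hind _ _ h).1⟩

/-- the freeness letter `hind` holds in any `F`-algebra that is a FIELD, as soon as `d` is not a square in `F` (e.g. `E′ = L_w` over `F = L⁺_v` at a
non-split place). [cite: Omeara1963, §63B] -/
theorem hind_of_not_isSquare {E' : Type*} [Field E'] [Algebra F E'] (δ' : E') (hδ : δ' * δ' = algebraMap F E' d)
    (hd : ¬ IsSquare d) (a b : F) (h : algebraMap F E' a + algebraMap F E' b * δ' = 0) : a = 0 ∧ b = 0 := by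
  by_cases hb : b = 0
  · subst hb
    have ha : algebraMap F E' a = 0 := by simpa using h
    exact ⟨(map_eq_zero _).1 ha, rfl⟩
  · exfalso
    have hb' : algebraMap F E' b ≠ 0 := (map_ne_zero _).2 hb
    have hδ' : δ' = algebraMap F E' (-a / b) := by
      rw [map_div₀, map_neg, eq_div_iff hb']
      linear_combination h
    refine hd ⟨-a / b, (algebraMap F E').injective ?_⟩
    rw [map_mul, ← hδ', hδ]

end Algebra


/-! ## §3 (ED. 2) Involution transfer: the bilinear orthogonality is ★ p864316's sesquilinear one after `T := A⁻¹ *ᵥ (c ∘ τ)` -/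

section Transfer

variable {E' : Type*} [CommRing E'] {m : Type*} [Fintype m] [DecidableEq m] (c : E' →+* E')

omit [DecidableEq m] in
/-- `(c ∘ s) ⬝ᵥ (c ∘ τ) = c (s ⬝ᵥ τ)`. [cite: Omeara1963, §63B] -/
theorem conj_dotProduct_conj (s τ : m → E') : (c ∘ s) ⬝ᵥ (c ∘ τ) = c (s ⬝ᵥ τ) := by
  simp only [dotProduct, Function.comp_apply, map_sum, map_mul]

/-- **THE CHANGE OF VARIABLE ON THE `t`-SIDE** (K2Liu-p08 PIN (1)): for `A` invertible and `T := A⁻¹ *ᵥ (c ∘ τ)`,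
`(c ∘ s) ⬝ᵥ A *ᵥ T = c (s ⬝ᵥ τ)` — no property of the Weil pairing is used. [cite: KudlaRallis1994, §2 (2.10)–(2.12)] -/
theorem conj_dotProduct_mulVec_frameVec {A : Matrix m m E'} (hdet : IsUnit A.det) (s τ : m → E') :
    (c ∘ s) ⬝ᵥ A *ᵥ (A⁻¹ *ᵥ (c ∘ τ)) = c (s ⬝ᵥ τ) := by
  rw [mulVec_mulVec, mul_nonsing_inv _ hdet, one_mulVec, conj_dotProduct_conj]

/-- **bilinear orthogonality ↔ sesquilinear orthogonality**: `s ⬝ᵥ τ = 0 ↔ (c ∘ s) ⬝ᵥ A *ᵥ (A⁻¹ *ᵥ (c ∘ τ)) = 0` (`c` an involution).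
[cite: KudlaRallis1994, §2 (2.10)–(2.12)] -/
theorem dotProduct_eq_zero_iff_conj_frameVec (hc : ∀ a, c (c a) = a) {A : Matrix m m E'} (hdet : IsUnit A.det) (s τ : m → E') :
    s ⬝ᵥ τ = 0 ↔ (c ∘ s) ⬝ᵥ A *ᵥ (A⁻¹ *ᵥ (c ∘ τ)) = 0 := by
  rw [conj_dotProduct_mulVec_frameVec c hdet]
  refine ⟨fun h => by rw [h, map_zero], fun h => ?_⟩
  rw [← hc (s ⬝ᵥ τ), h, map_zero]

/-- the self-pairing of the frame vector: `(c ∘ T) ⬝ᵥ A *ᵥ T = c (T ⬝ᵥ τ)` for `T := A⁻¹ *ᵥ (c ∘ τ)` (the value the consumer's `qf` pin reads).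
[cite: KudlaRallis1994, §2 (2.10)–(2.12)] -/
theorem conj_frameVec_dotProduct_mulVec_frameVec {A : Matrix m m E'} (hdet : IsUnit A.det) (τ : m → E') :
    (c ∘ (A⁻¹ *ᵥ (c ∘ τ))) ⬝ᵥ A *ᵥ (A⁻¹ *ᵥ (c ∘ τ)) = c ((A⁻¹ *ᵥ (c ∘ τ)) ⬝ᵥ τ) := by
  rw [mulVec_mulVec, mul_nonsing_inv _ hdet, one_mulVec, conj_dotProduct_conj]

end Transfer

/-! ## §4 (ED. 2) The record: `hWitt` from ★ p864316 [A4-alg] §3 through the dictionary -/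

section Record

open NumberField IsDedekindDomain
open Literature.NumberTheory.Automorphic Literature.NumberTheory.Automorphic.UnitaryGroup Literature.NumberTheory.GaloisRepresentations
open Literature.NumberTheory.QuadraticForms Literature.NumberTheory.Rogawski1990

/-- **`hWitt` AT A NON-SPLIT PLACE OF THE RECORD.**  `L` CM, `v` a finite place of `L⁺` with `w ∣ v` fixed by complex conjugation, `σ_w` the local involution,
`ι_w = toPlace v w`; quadratic coordinates `eJ, eJ′` (3 `E_w`-coordinates), `d ∈ L⁺_v` NOT a square with `δ′² = ι_w(d)` in `L_w`; the multiplication graph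
`Zm` (`hZm`); a `σ_w`-hermitian `A ∈ M₃(L_w)` with `det A = ι_w(a)`, `a ≠ 0`.  NAMES with defining letters: `sE j = ι_w(x_j) + ι_w(y_j)·δ′` (the cone variable
in `E_w`), `τE j = ι_w(t_{j1}) + ι_w(t_{j0})·δ′` (the slot-swapped 𝓕-variable), `T = A⁻¹ *ᵥ (σ_w ∘ τE)` (PIN (1)).  IF `s ≠ 0`, `sE` is isotropic
(`(σ_w ∘ sE) ⬝ᵥ A *ᵥ sE = 0` — the consumer's `Qc s = 0` reading), `t ⊥ image(ζ ↦ Z_s ζ)` (`∀ ζ, t ⬝ᵥ Zm s ζ = 0`) and `ι_w(b) = (σ_w ∘ T) ⬝ᵥ A *ᵥ T` (the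
consumer's `qf` reading), THEN **`b = 0 ∨ (−b·a⁻¹, θ)_v = 1`** (`θ = cmQuadraticGenerator L`).  Proof: `sE ≠ 0` (freeness of `{1, δ′}`, ★ `hind_of_not_isSquare`);
`sE ⬝ᵥ τE = 0` (★ `forall_dotProduct_zm_eq_zero_iff_sum_eq_zero`); §3 turns it into `(σ_w ∘ sE) ⬝ᵥ A *ᵥ T = 0`; ★ p864316 §3
`hilbertSymbol_neg_self_pairing_div_det_eq_one`. [cite: Omeara1963, §63B (63:10)] [cite: KudlaRallis1994, §2 (2.10)–(2.12)] -/
theorem hWitt_of_normClass (L : Type) [Field L] [NumberField L] [IsCMField L] (v : HeightOneSpectrum (𝓞 ↥(maximalRealSubfield L)))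
    (w : PlacesOver L v) (hw : IsCMField.complexConj L • w.1 = w.1)
    {ι₁ ι₁' : Type*} [Fintype ι₁] (eJ : Fin 3 × Fin 2 ≃ ι₁) (eJ' : Fin 3 × Fin 2 ≃ ι₁')
    {d : v.adicCompletion ↥(maximalRealSubfield L)} (hd : ¬ IsSquare d) (δ' : w.1.adicCompletion L) (hδ : δ' * δ' = toPlace v w d)
    (Zm : (ι₁' → v.adicCompletion ↥(maximalRealSubfield L)) → ((Fin 2 → v.adicCompletion ↥(maximalRealSubfield L)) →ₗ[v.adicCompletion ↥(maximalRealSubfield L)]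
      (ι₁ → v.adicCompletion ↥(maximalRealSubfield L))))
    (hZm : ∀ (s : ι₁' → v.adicCompletion ↥(maximalRealSubfield L)) (ζ : Fin 2 → v.adicCompletion ↥(maximalRealSubfield L)) (j : Fin 3),
      Zm s ζ (eJ (j, 0)) = ζ 0 * s (eJ' (j, 0)) + d * ζ 1 * s (eJ' (j, 1)) ∧
      Zm s ζ (eJ (j, 1)) = ζ 0 * s (eJ' (j, 1)) + ζ 1 * s (eJ' (j, 0)))
    {A : Matrix (Fin 3) (Fin 3) (w.1.adicCompletion L)}
    (hA : ∀ i j, galAdicCompletionMap (L := L) (IsCMField.complexConj L) hw (A i j) = A j i)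
    {a : v.adicCompletion ↥(maximalRealSubfield L)} (ha : a ≠ 0) (hdetA : A.det = toPlace v w a)
    {s : ι₁' → v.adicCompletion ↥(maximalRealSubfield L)} (hs : s ≠ 0) (t : ι₁ → v.adicCompletion ↥(maximalRealSubfield L))
    (sE τE T : Fin 3 → w.1.adicCompletion L)
    (hsE : ∀ j, sE j = toPlace v w (s (eJ' (j, 0))) + toPlace v w (s (eJ' (j, 1))) * δ')
    (hτE : ∀ j, τE j = toPlace v w (t (eJ (j, 1))) + toPlace v w (t (eJ (j, 0))) * δ')
    (hT : T = A⁻¹ *ᵥ (galAdicCompletionMap (L := L) (IsCMField.complexConj L) hw ∘ τE))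
    (hss : (galAdicCompletionMap (L := L) (IsCMField.complexConj L) hw ∘ sE) ⬝ᵥ A *ᵥ sE = 0)
    (horth : ∀ ζ : Fin 2 → v.adicCompletion ↥(maximalRealSubfield L), t ⬝ᵥ Zm s ζ = 0)
    {b : v.adicCompletion ↥(maximalRealSubfield L)}
    (hbT : (galAdicCompletionMap (L := L) (IsCMField.complexConj L) hw ∘ T) ⬝ᵥ A *ᵥ T = toPlace v w b) :
    b = 0 ∨ hilbertSymbol (v.adicCompletion ↥(maximalRealSubfield L)) (-(b * a⁻¹))
      (algebraMap ↥(maximalRealSubfield L) _ (cmQuadraticGenerator L : ↥(maximalRealSubfield L))) = 1 := by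
  have hσσ : ∀ x : w.1.adicCompletion L, galAdicCompletionMap (L := L) (IsCMField.complexConj L) hw
      (galAdicCompletionMap (L := L) (IsCMField.complexConj L) hw x) = x :=
    galAdicCompletionMap_galAdicCompletionMap_of_smul_eq (IsCMField.complexConj L) w (IsCMField.complexConj_ne_one L) hw
  have hta : toPlace v w a ≠ 0 := (map_ne_zero _).2 ha
  have hdet : IsUnit A.det := by
    rw [hdetA]
    exact isUnit_iff_ne_zero.2 hta
  letI : Algebra (v.adicCompletion ↥(maximalRealSubfield L)) (w.1.adicCompletion L) := (toPlace v w).toAlgebra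
  have halg : ∀ x, algebraMap (v.adicCompletion ↥(maximalRealSubfield L)) (w.1.adicCompletion L) x = toPlace v w x := fun _ => rfl
  have hδa : δ' * δ' = algebraMap (v.adicCompletion ↥(maximalRealSubfield L)) (w.1.adicCompletion L) d := by rw [halg]; exact hδ
  have hind : ∀ p q : v.adicCompletion ↥(maximalRealSubfield L),
      algebraMap _ (w.1.adicCompletion L) p + algebraMap _ (w.1.adicCompletion L) q * δ' = 0 → p = 0 ∧ q = 0 :=
    hind_of_not_isSquare d δ' hδa hd
  -- `sE ≠ 0`
  have hsE0 : sE ≠ 0 := by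
    intro h0
    refine hs (funext fun i => ?_)
    obtain ⟨⟨j, c⟩, rfl⟩ := eJ'.surjective i
    have hj0 : sE j = 0 := by rw [h0]; rfl
    rw [hsE j, ← halg, ← halg] at hj0
    have hj := hind _ _ hj0
    fin_cases c <;> first | simpa using hj.1 | simpa using hj.2
  -- `sE ⬝ᵥ τE = 0`
  have hsum : sE ⬝ᵥ τE = 0 := by
    have h := (forall_dotProduct_zm_eq_zero_iff_sum_eq_zero eJ eJ' d Zm hZm (w.1.adicCompletion L) δ' hδa hind t s).1 horth
    simp only [halg, ← hsE, ← hτE] at h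
    exact h
  -- hence `T ⊥ sE` for the hermitian form
  have hst : (galAdicCompletionMap (L := L) (IsCMField.complexConj L) hw ∘ sE) ⬝ᵥ A *ᵥ T = 0 := by
    rw [hT, conj_dotProduct_mulVec_frameVec _ hdet, hsum, map_zero]
  by_cases hb : b = 0
  · exact Or.inl hb
  · exact Or.inr (K2LiuIsotropicOrthogonalNormClass.hilbertSymbol_neg_self_pairing_div_det_eq_one L v w hw hA ha hb hdetA hsE0 hss T
      hst hbT)

/-- **`hWitt` FROM THE TWO PHASE LETTERS** (desk WORD #49 shape): with the consumer's readings BY VALUE — `ι_w(Qc s) = ι_w(κ₁)·h(sE, sE)` (pin (2a)) and, for the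
phase value `qv := qf (t ⊔ s)`, `ι_w(qv) = ι_w(κ₂)·h(T, T)` (pin (2b)), units `κ₁ κ₂ ≠ 0` of `L⁺_v` — the cone letter `Qc s = 0` and `t ⊥ image(ζ ↦ Z_s ζ)` give
**`qv = 0 ∨ (−qv·(κ₂·a)⁻¹, θ)_v = 1`**: the class scalar of record ABSORBS `κ₂` (`a′ := κ₂·a`; no assumption `(κ₂, θ)_v = 1`).
[cite: Omeara1963, §63B (63:10)] [cite: KudlaRallis1994, §2 (2.10)–(2.12)] -/
theorem hWitt_of_phaseLetters (L : Type) [Field L] [NumberField L] [IsCMField L] (v : HeightOneSpectrum (𝓞 ↥(maximalRealSubfield L)))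
    (w : PlacesOver L v) (hw : IsCMField.complexConj L • w.1 = w.1)
    {ι₁ ι₁' : Type*} [Fintype ι₁] (eJ : Fin 3 × Fin 2 ≃ ι₁) (eJ' : Fin 3 × Fin 2 ≃ ι₁')
    {d : v.adicCompletion ↥(maximalRealSubfield L)} (hd : ¬ IsSquare d) (δ' : w.1.adicCompletion L) (hδ : δ' * δ' = toPlace v w d)
    (Zm : (ι₁' → v.adicCompletion ↥(maximalRealSubfield L)) → ((Fin 2 → v.adicCompletion ↥(maximalRealSubfield L)) →ₗ[v.adicCompletion ↥(maximalRealSubfield L)]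
      (ι₁ → v.adicCompletion ↥(maximalRealSubfield L))))
    (hZm : ∀ (s : ι₁' → v.adicCompletion ↥(maximalRealSubfield L)) (ζ : Fin 2 → v.adicCompletion ↥(maximalRealSubfield L)) (j : Fin 3),
      Zm s ζ (eJ (j, 0)) = ζ 0 * s (eJ' (j, 0)) + d * ζ 1 * s (eJ' (j, 1)) ∧
      Zm s ζ (eJ (j, 1)) = ζ 0 * s (eJ' (j, 1)) + ζ 1 * s (eJ' (j, 0)))
    {A : Matrix (Fin 3) (Fin 3) (w.1.adicCompletion L)}
    (hA : ∀ i j, galAdicCompletionMap (L := L) (IsCMField.complexConj L) hw (A i j) = A j i)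
    {a : v.adicCompletion ↥(maximalRealSubfield L)} (ha : a ≠ 0) (hdetA : A.det = toPlace v w a)
    {s : ι₁' → v.adicCompletion ↥(maximalRealSubfield L)} (hs : s ≠ 0) (t : ι₁ → v.adicCompletion ↥(maximalRealSubfield L))
    (sE τE T : Fin 3 → w.1.adicCompletion L)
    (hsE : ∀ j, sE j = toPlace v w (s (eJ' (j, 0))) + toPlace v w (s (eJ' (j, 1))) * δ')
    (hτE : ∀ j, τE j = toPlace v w (t (eJ (j, 1))) + toPlace v w (t (eJ (j, 0))) * δ')
    (hT : T = A⁻¹ *ᵥ (galAdicCompletionMap (L := L) (IsCMField.complexConj L) hw ∘ τE))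
    (horth : ∀ ζ : Fin 2 → v.adicCompletion ↥(maximalRealSubfield L), t ⬝ᵥ Zm s ζ = 0)
    {Qcs κ₁ qv κ₂ : v.adicCompletion ↥(maximalRealSubfield L)} (hκ₁ : κ₁ ≠ 0) (hκ₂ : κ₂ ≠ 0)
    (hQc : toPlace v w Qcs = toPlace v w κ₁ * ((galAdicCompletionMap (L := L) (IsCMField.complexConj L) hw ∘ sE) ⬝ᵥ A *ᵥ sE))
    (hqf : toPlace v w qv = toPlace v w κ₂ * ((galAdicCompletionMap (L := L) (IsCMField.complexConj L) hw ∘ T) ⬝ᵥ A *ᵥ T))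
    (hQ0 : Qcs = 0) :
    qv = 0 ∨ hilbertSymbol (v.adicCompletion ↥(maximalRealSubfield L)) (-(qv * (κ₂ * a)⁻¹))
      (algebraMap ↥(maximalRealSubfield L) _ (cmQuadraticGenerator L : ↥(maximalRealSubfield L))) = 1 := by
  have hκ₁' : toPlace v w κ₁ ≠ 0 := (map_ne_zero _).2 hκ₁
  have hκ₂' : toPlace v w κ₂ ≠ 0 := (map_ne_zero _).2 hκ₂
  have hss : (galAdicCompletionMap (L := L) (IsCMField.complexConj L) hw ∘ sE) ⬝ᵥ A *ᵥ sE = 0 := by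
    have h := hQc
    rw [hQ0, map_zero] at h
    exact (mul_eq_zero.1 h.symm).resolve_left hκ₁'
  have hbT : (galAdicCompletionMap (L := L) (IsCMField.complexConj L) hw ∘ T) ⬝ᵥ A *ᵥ T = toPlace v w (qv / κ₂) := by
    rw [map_div₀, hqf, mul_div_cancel_left₀ _ hκ₂']
  rcases hWitt_of_normClass L v w hw eJ eJ' hd δ' hδ Zm hZm hA ha hdetA hs t sE τE T hsE hτE hT hss horth hbT with h | h
  · exact Or.inl ((div_eq_zero_iff.1 h).resolve_right hκ₂)
  · right
    rw [show -(qv * (κ₂ * a)⁻¹) = -(qv / κ₂ * a⁻¹) by rw [mul_inv, div_eq_mul_inv, mul_assoc]]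
    exact h

end Record

end Summit.HodgeConjecture.HodgeConjecture.Cruxes.HLiu418.K2LiuConeWittDictionary
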